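import Summits.QuantumAdvantage.QuantumAdvantage.Theorems.CubicForrelationNearExactIsExactTenUnbalancedPartner

/-!
# Crux `CubicForrelation.NearExactIsExact` (stmt-QuantumAdvantage-14043), line `direct-sum-amplification`, lead c6 cycle 2:
  isolation at `θ = 7/8` on 10 bits modulo the CORRECTED finite proposition CENSUS₁₀′

The g-side congruence system of `ten_unbalanced_cells` alone has solutions (exact census, h = 3: classes with an exactly flat 64-cell),
so `isolation_ten_78_of_census` is vacuous; the corrected proposition quantifies over the transported cubic partner as well
(`ten_unbalanced_cells_partner`): CENSUS₁₀′ = no (E,D,Q,bh) with the cell congruences has a cubic `f₁` with `Φ(f₁, g_{E,D,Q}) > 7/8`.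
Axioms: standard three.

STATUS (2026-08-18, seat `b2b-cforr-cert`; what is proved at which `n`).  KERNEL-CHECKED: `θ = 7/8` for every even `n ≤ 8`
(`isolation_eight`, `nearExact78_le_six`), `θ = 15/16` at `n = 10` (`isolation_ten`), the reduction of `θ = 7/8` at `n = 10` to
CENSUS₁₀′ (this file) and the emptiness of its affine-`D` family (`census10_no_affine_D`, `isolation_ten_78_of_census3`).
UPDATE 2026-08-18 (seat 1): CENSUS₁₀′ itself is now KERNEL-CHECKED — proved outright, without any census, as
`census10_prime_false` (…TenIsolation78Final.lean: restrict the partner to the heavy hyperplane and run the 2-adic Walsh tower of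
that 9-bit cubic against the Fourier identity of the heavy cell sums); hence `isolation_ten_78` is UNCONDITIONAL and the
outside-Lean censuses (kit j025070–j025074; j038490–j038495, j041314/5, j038921 — h = 4 complete, h = 3 partial, h = 2 open there)
are superseded.  Sharpness: `7/8` is attained at `n = 10` (`forrelation_fT_gT`), so `7/8` IS
the exact threshold at `n = 10`; it is NOT the crux's global constant — `Φ = 15/16 < 1` occurs at `n = 16`
(`Negative/FifteenSixteenths.lean`), forcing `θ ≥ 15/16` in `NearExactIsExact`.
-/

set_option linter.dupNamespace false -- D-0017: single-problem summit ⇒ `QuantumAdvantage.QuantumAdvantage` by design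

noncomputable section

namespace Summit.QuantumAdvantage.QuantumAdvantage.Theorems.CubicForrelation.NearExactIsExact

open Finset
open Literature.Computability.QuantumComplexity

/-- **Isolation at `7/8` on 10 bits, modulo the corrected census.** If no `(E, D, Q, bh)` satisfying the cell congruence system
admits a cubic partner `f₁` with `Φ(f₁, g_{E,D,Q}) > 7/8` (CENSUS₁₀′ — a THEOREM since 2026-08-18: `census10_prime_false`),
then `Φ(f,g) > 7/8 ⇒ Φ(f,g) = 1` for all cubic `f, g : 𝔽₂¹⁰ → 𝔽₂`.  The unconditional statement is `isolation_ten_78`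
(…TenIsolation78Final.lean). [lead c6 cycle 2] -/
theorem isolation_ten_78_of_census2 :
    (∀ (E D Q : (Fin (4 + 4) → Bool) → Bool) (bh : Bool) (f₁ : (Fin (4 + 4 + 1 + 1) → Bool) → Bool),
      IsDegLeFun 3 E → IsDegLeFun 2 D → IsDegLeFun 2 Q → IsDegLeFun 3 f₁ →
      (∑ w, signOf (Q w)) ≠ 0 → |∑ w, signOf (Q w)| < 128 →
      (∀ (a : Bool) (x : Fin (4 + 4) → Bool), ∃ k : ℤ,
        (∑ w : Fin (4 + 4) → Bool, if (D w = a ∧ Q w = bh) then signOf (E w) * twist w x else 0) = 8 * (2 * (k : ℝ) + 1)) →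
      (∀ (a : Bool) (x : Fin (4 + 4) → Bool), ∃ k : ℤ,
        (∑ w : Fin (4 + 4) → Bool, if (D w = a ∧ Q w = !bh) then signOf (E w) * twist w x else 0) = 4 * (2 * (k : ℝ) + 1)) →
      7 / 8 < forrelation f₁ (fun y : Fin (4 + 4 + 1 + 1) → Bool =>
            E (fun i : Fin (4 + 4) => y (Fin.castLE (by omega) i)) ^^
              (y ⟨8, by norm_num⟩ && D (fun i : Fin (4 + 4) => y (Fin.castLE (by omega) i))) ^^
              (y ⟨9, by norm_num⟩ && Q (fun i : Fin (4 + 4) => y (Fin.castLE (by omega) i)))) → False) →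
    ∀ f g : (Fin (4 + 4 + 1 + 1) → Bool) → Bool, IsDegLeFun 3 f → IsDegLeFun 3 g →
      7 / 8 < forrelation f g → forrelation f g = 1 := by
  intro hcensus f g hf hg hΦ
  by_contra hne
  have hle : forrelation f g ≤ 1 := (abs_le.1 (SgnForrMem.abs_forrelation_le_one f g)).2
  have hlt : forrelation f g < 1 := lt_of_le_of_ne hle hne
  obtain ⟨E, D, Q, bh, hE, hD, hQ, hQne, hQlt, hH, hL, f₁, hf₁, hΦ₁⟩ := ten_unbalanced_cells_partner f g hf hg hΦ hlt
  exact hcensus E D Q bh f₁ hE hD hQ hf₁ hQne hQlt hH hL (by rw [hΦ₁]; exact hΦ)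

end Summit.QuantumAdvantage.QuantumAdvantage.Theorems.CubicForrelation.NearExactIsExact
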